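import Mathlib.Analysis.SpecialFunctions.ExpDeriv
import Literature.MathematicalPhysics.QuantumFieldTheory.Balaban1983to89.B13AccretiveOfRealCoercive
import Literature.MathematicalPhysics.QuantumLattice.LieTrotter

/-!
# `Balaban1983to89.B13PolynomialRangeLetters` — T. Bałaban, *Propagators for lattice gauge theories in a background field*,
Commun. Math. Phys. **99** (1985) 389–434 [Balaban1985BackgroundPropagators], p. 390 («U′ = exp iηA», «U = U′U₀»), (3.23)–(3.26)
pp. 394–395 (the LOCAL operators of the effective action: the covariant Laplacian `Δ_U`, the averaging sandwich `Q*_k a Q_k`, `Δ′_a`),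
Thm 3.4 p. 400 (the operators «extend to configurations U′U … as analytic functions of A») and (3.50) p. 400
(`Δ_{U′U}λ(x) = η⁻²(2dλ(x) − Σ_b exp(iη ad A(b))R(U_b)λ(b₊))` — an «analytic function of A(b)»: the covariant Laplacian's entries ARE
transport letters `exp(L_b u)·U₀(b)` with `L_b u = iη ad A(b)`, `U₀(b) = R(U_b)`), Thm 3.10 (3.108) p. 416 (the class of kernels
`|G(x,x′)| ≤ Be^{−δd(x,x′)}`); *Renormalization group approach to lattice gauge field theories. II. Cluster
expansions*, Commun. Math. Phys. **116** (1988) 1–22 [Balaban1988RG2Cluster], (2.5) p. 12 and p. 15 («The general case is handled by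
a perturbative argument … analytic functions of the complex variables»); *I*, Commun. Math. Phys. **109** (1987) 249–301
[Balaban1987RG1], p. 263 (analyticity of the densities in the complexified gauge fields): THE LETTERS OF A LOCAL OPERATOR ARE A
FORMULA-LEVEL CONSEQUENCE OF RANGE + BOUND + HOLOMORPHY — the census class (C) («complexification») for the LOCAL pieces.

statement-level complex analysis ([folklore]: holomorphy and sup bounds, on a ball of a complex normed space, of finite sums of
images under continuous linear functionals of finite ORDERED products of bounded holomorphic letters with values in a normed
ℂ-algebra — exponential polynomials in finitely many chart coordinates) packaged in the tree's entry-letter currency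
`B13EntrywiseWalks.RawEntryLetters` over the landed family lemma `B13AccretiveOfRealCoercive.rawEntryLetters_of_range_family`
(pub-ymgap dag-n10-c g12, module 56A) and `QuantumLattice.norm_exp_le` (‖exp a‖ ≤ e^{‖a‖}), with citation tags; kernel-checked;
THEOREMS ONLY (no `def`, no `structure`, no instance, no notation); nothing here is a claim about the Yang–Mills mass gap; NOTHING
of Bałaban's operators `Δ_U`, `Q*_k a Q_k`, `Δ′_a`, `Δ_k` is defined or asserted — their formulas of record are node N06's ∕ NODE 00's
(`Node00/OpsY*`, `B9SectBGp*`); no node is discharged; count-neutral.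

WHY THIS FILE (cell `pub-ymgap`, HUMAN RULING D-0062 ∕ D-0149, Track A node N10 = [B13]; width seat `pub-ymgap-dag-n10-w4` g0, item (D)
of the n10-c lane's `N10-W-SEAT-BRIEF.md` §3 = plan's `W-SEAT-START-LIST.md` v3 § n10; census `N10-RESIDUAL-CENSUS-v14.md` row
«complexification (C)»).  The N10 junction editions (`Thm/BalabanUVNodesN10B13KernelTowerWalksEntrywise` (51C) binder `hEL`,
`Thm/BalabanUVNodesN10EntryLettersOfN06RecordFaceC` (58B) binder `hAL`) consume, per located kernel family `u ↦ A(u)` on a complex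
chart ball `‖u‖ < R`, the TWO ENTRYWISE LETTERS `RawEntryLetters A loc R ρ B` — entrywise (3.108)-decay at rate `ρ` and entrywise
holomorphy.  For a LOCAL operator (entries vanish beyond `d₁`-distance `r₀` of the locations) module 56A's
`rawEntryLetters_of_range_family` reduces the letters to holomorphy + ONE uniform bound `a` on the ball (letters `(R, ρ, a·e^{ρ r₀})`
at every rate `ρ ≥ 0`); module 34 `B13EntryLetterAlgebra` closes the letters under sums, products and local sandwiches — but all its
ATOMS are `u`-CONSTANT (`rawEntryLetters_const ∕ _of_range`).  THIS FILE supplies the `u`-DEPENDENT local atom at formula level: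
the matrix entries of `Δ_U`, `Q*_k a Q_k`, `Δ′_a` at `U = U′U₀`, `U′ = exp iηA` (p. 390), read on a complex chart `A = A(u)`, are finite
sums of representation coordinates (continuous linear functionals) of PARALLEL TRANSPORTS ALONG FINITE CONTOURS — ordered
products («words») of the link letters `exp(L_b u)·U₀(b)` and `U₀(b)⁻¹·exp(−L_b u)` — and such exponential polynomials are
holomorphic with an explicit sup bound on every ball.  Once NODE 00 ∕ N06 write the complexified formulas of their operators in this
shape, `hEL` ∕ `hAL` for the local pieces follow BY NAME from §3–§4 below (the consumer states the word expansion `hA` on the ball and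
the two numerals `Λ ≥ ‖L_b‖`, `K₀ ≥ ‖U₀(b)^{±1}‖`).

WHAT THIS FILE PROVES (all `theorem`s).  Letters `g : β → E → 𝔸` into a normed ℂ-algebra `𝔸` with `‖1‖ = 1` (`[NormedRing 𝔸]
[NormedAlgebra ℂ 𝔸] [NormOneClass 𝔸]`; complete for the exponential atoms), words `w : List β`, the word product
`(w.map fun b => g b u).prod` (empty word ↦ `1`; cf. the `Fin k`-indexed twin `Literature.Analysis.Calculus.BCH.wordProd`).
* §1 WORD CALCULUS: `differentiableOn_listProd_map` (every letter holomorphic on `s` ⟹ every word product holomorphic on `s`),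
  `norm_listProd_map_le` (`‖a b‖ ≤ M b` ⟹ `‖(w.map a).prod‖ ≤ (w.map M).prod`), `differentiableOn_sum_clm_listProd`,
  `norm_sum_clm_listProd_le` (finite sums `Σ_{s∈S} φ_s(word_s)` of images under `φ_s : 𝔸 →L[ℂ] ℂ`: holomorphic, norm
  `≤ Σ ‖φ_s‖·(w_s.map M).prod`); private plumbing `listProd_map_const` (a constant letter bound `K` gives `K^{|w|}`).
* §2 ATOMS ON THE CHART BALL `‖u‖ < R` (private plumbing `norm_clm_apply_le_of_mem_ball`: `‖ℓ u‖ ≤ ‖ℓ‖·R`): `differentiable_exp_clm` ∕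
  `norm_exp_clm_le_of_mem_ball` (`u ↦ exp(L u)`, `L : E →L[ℂ] 𝔸`: entire, `≤ e^{‖L‖R}` on the ball), `differentiable_exp_clm_mul_const` ∕
  `norm_exp_clm_mul_const_le` (the forward transport letter `exp(L u)·U₀`), `differentiable_const_mul_exp_neg_clm` ∕
  `norm_const_mul_exp_neg_clm_le` (the backward letter `V₀·exp(−L u)`), `differentiable_cexp_clm` ∕ `norm_cexp_clm_le_of_mem_ball`
  (scalar `cexp (ℓ u)`).
* §3 ★ THE PACKAGING (census class (C), generic): `rawEntryLetters_of_words` — entries `A u i j = Σ_{s ∈ S i j} φ_s(word_s(u))` ON THE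
  BALL (agreement on the ball only: `A` may be any global formula), letters holomorphic on the ball with bounds `M b` there,
  `S i j = ∅` whenever `r₀ < d₁(loc i, loc j)` (RANGE `r₀`), `Σ_{s∈S i j} ‖φ_s‖·(w_s.map M).prod ≤ a`, `0 ≤ a`, `0 ≤ ρ`
  ⟹ `RawEntryLetters A loc R ρ (a·e^{ρ r₀})` (56A `rawEntryLetters_of_range_family` BY NAME).
* §4 SPECIALISATIONS: `rawEntryLetters_of_expPolynomial` (`𝔸 = ℂ`: `A u i j = Σ_{s∈S i j} c_s·e^{ℓ_s u}`, `ℓ_s : E →L[ℂ] ℂ` — a product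
  of exponentials of linear coordinates is ONE exponential of their sum — range `r₀` ⟹ letters `(R, ρ, a·e^{ρ r₀})`,
  `a ≥ Σ‖c_s‖e^{‖ℓ_s‖R}`, every `R ≥ 0`, `ρ ≥ 0`), `rawEntryLetters_of_polynomial` (plain polynomials `Σ c_s·Π_{b∈w_s} ℓ_b u`, bound
  `Σ‖c_s‖·Π(‖ℓ_b‖R)`), ★ `rawEntryLetters_of_transportWords` (THE LINK-VARIABLE SHAPE: bonds `β`, chart readings
  `L : β → E →L[ℂ] 𝔸`, `‖L b‖ ≤ Λ`, background values `U₀ V₀ : β → 𝔸` of norm `≤ K₀`, letters on `β ⊕ β` = forward `exp(L b u)·U₀ b` ∕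
  backward `V₀ b·exp(−L b u)`, entries `Σ_s φ_s(word)`, range `r₀` ⟹ letters `(R, ρ, a·e^{ρ r₀})`, `a ≥ Σ_s ‖φ_s‖·(K₀e^{ΛR})^{|w_s|}`).
* §6 (v1.1, append-only) THE REAL POINT OF THE CHART: `listProd_transport_zero` (at `u = 0` every transport letter is its
  background value, a word product is the background word `Π(U₀|V₀)`), `transportWords_apply_zero` (the entries of a transport-word
  family at `u = 0` are the functionals of the background words — the algebraic half of the junction's real-point identity
  `Aop 0 = M(Δ_a(U₀))`; identifying the right side with the real operator's matrix of record is the consumer's reading).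
* §5 NON-VACUITY (director-ym №189 A6 rule): `rawEntryLetters_oneBondU1` — the one-bond U(1) covariant second difference
  `u ↦ [[1, −e^{iu}], [−e^{−iu}, 1]]` over the chart `E = 𝔸 = ℂ`, `p = Fin 2`, inhabits §4's ★ theorem with every binder discharged
  (letters `(R, ρ, e^{R}·e^{ρ r₀})` at `r₀ = d₁(loc 0, loc 1)`, any locations), and `oneBondU1_entry_ne` — GENUINE `u`-dependence.
HONEST FRAMING: [folklore] complex analysis in the tree's letter currency; NOTHING of Bałaban's is constructed or asserted (which
words, which functionals, which `Λ`, `K₀`, `r₀` the operators of (3.23)–(3.26) have is their owners' formula of record); N10 NOT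
discharged; K1⁷ NOT closed; counts unmoved; no `sorry`, no new named fact; standard axioms; one finite 𝕋⁴ programme at fixed ε,
Bałaban AS PRINTED; the YM mass gap (Clay) is NOT proved by any of this — R4 closes the conditional finite-𝕋⁴ rung
`BalabanLadder.UV` only; nothing continuum ∕ ℝ⁴ ∕ OS.

References: T. Bałaban, CMP 99 (1985) 389–434 [Balaban1985BackgroundPropagators] p.390, (3.23)–(3.26) pp.394–395, (3.37) p.396,
Thm 3.4 and (3.50) p.400, Thm 3.10 (3.107)–(3.108) pp.415–416; CMP 116 (1988) 1–22 [Balaban1988RG2Cluster] (2.5) p.12, p.15; CMP 109 (1987)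
249–301 [Balaban1987RG1] p.263; CMP 96 (1984) 223–250 [Balaban1984PropagatorsII] (2.52) p.232 (composition of decaying kernels).
-/

noncomputable section

namespace Literature.MathematicalPhysics.QuantumFieldTheory.Balaban1983to89.B13PolynomialRangeLetters

open Metric Set Finset
open scoped Matrix
open NormedSpace (exp)
open Literature.MathematicalPhysics.QuantumFieldTheory.Balaban1983to89
open Literature.MathematicalPhysics.QuantumFieldTheory.Balaban1983to89.B9Thm37GlueTorus (tdist1 tdist1_nonneg tdist1_comm tdist1_self)
open Literature.MathematicalPhysics.QuantumFieldTheory.Balaban1983to89.B5TorusCover (UT)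
open Literature.MathematicalPhysics.QuantumFieldTheory.Balaban1983to89.B13EntrywiseWalks (RawEntryLetters)
open Literature.MathematicalPhysics.QuantumFieldTheory.Balaban1983to89.B13AccretiveOfRealCoercive (rawEntryLetters_of_range_family)
open Literature.MathematicalPhysics.QuantumLattice (norm_exp_le)

variable {ν : ℕ} {Nf : Fin ν → ℕ} [∀ i, NeZero (Nf i)]
variable {E : Type*} [NormedAddCommGroup E] [NormedSpace ℂ E]
variable {𝔸 : Type*} [NormedRing 𝔸] [NormedAlgebra ℂ 𝔸] [NormOneClass 𝔸]
variable {p : Type}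

/-! ## §1. Word calculus: ordered products of bounded holomorphic letters, their functionals, finite sums -/

section Words

variable {β σ : Type*}

omit [NormOneClass 𝔸] in
/-- Every letter holomorphic on `s` ⟹ every WORD PRODUCT `u ↦ Π_{b ∈ w} g_b(u)` (ordered, `𝔸` non-commutative) holomorphic on `s`
(induction on the word over Mathlib's `DifferentiableOn.mul`; the parallel transport along a contour as a function of the complexified
gauge field, [B9] Thm 3.4 p. 400, «analytic function of A(b)»). [cite: Balaban1985BackgroundPropagators, Thm 3.4 p.400] -/
theorem differentiableOn_listProd_map {g : β → E → 𝔸} {s : Set E} (hg : ∀ b, DifferentiableOn ℂ (g b) s) :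
    ∀ w : List β, DifferentiableOn ℂ (fun u => (w.map fun b => g b u).prod) s
  | [] => by simpa only [List.map_nil, List.prod_nil] using differentiableOn_const (1 : 𝔸)
  | b :: w => by
      simpa only [List.map_cons, List.prod_cons] using (hg b).fun_mul (differentiableOn_listProd_map hg w)

omit [NormedAlgebra ℂ 𝔸] in
/-- Letter bounds multiply along a word: `‖a_b‖ ≤ M_b` for every letter ⟹ `‖Π_{b∈w} a_b‖ ≤ Π_{b∈w} M_b` (`‖1‖ = 1` for the empty
word; [4] p. 232 «this property is preserved under the composition of operators possessing it»).
[cite: Balaban1984PropagatorsII, (2.52) p.232] -/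
theorem norm_listProd_map_le {a : β → 𝔸} {M : β → ℝ} (hM : ∀ b, ‖a b‖ ≤ M b) :
    ∀ w : List β, ‖(w.map a).prod‖ ≤ (w.map M).prod
  | [] => by simp only [List.map_nil, List.prod_nil, norm_one, le_refl]
  | b :: w => by
      rw [List.map_cons, List.prod_cons, List.map_cons, List.prod_cons]
      exact (norm_mul_le _ _).trans
        (mul_le_mul (hM b) (norm_listProd_map_le hM w) (norm_nonneg _) ((norm_nonneg _).trans (hM b)))

omit [NormedRing 𝔸] [NormedAlgebra ℂ 𝔸] [NormOneClass 𝔸] in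
/-- A CONSTANT letter bound `K` gives the word bound `K^{|w|}` (list plumbing). [folklore] -/
private theorem listProd_map_const (K : ℝ) (w : List β) : (w.map fun _ => K).prod = K ^ w.length := by
  rw [List.map_const', List.prod_replicate]

omit [NormOneClass 𝔸] in
/-- Finite sums of continuous-linear-functional images of word products are holomorphic where the letters are
(the matrix entry of a local gauge-covariant operator as a function of the complexified field, [B9] Thm 3.4 and (3.50) p. 400).
[cite: Balaban1985BackgroundPropagators, Thm 3.4 and (3.50) p.400] -/
theorem differentiableOn_sum_clm_listProd {g : β → E → 𝔸} {s : Set E} (hg : ∀ b, DifferentiableOn ℂ (g b) s)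
    (S : Finset σ) (φ : σ → 𝔸 →L[ℂ] ℂ) (w : σ → List β) :
    DifferentiableOn ℂ (fun u => ∑ t ∈ S, φ t (((w t).map fun b => g b u).prod)) s :=
  DifferentiableOn.fun_sum fun t _ => (φ t).differentiable.comp_differentiableOn (differentiableOn_listProd_map hg (w t))

/-- … and are bounded by `Σ_s ‖φ_s‖·Π_{b∈w_s} M_b` (the uniform bound of a local operator's entry on the complex neighbourhood,
[B9] Thm 3.4 p. 400; composition bound [4] (2.52)). [cite: Balaban1985BackgroundPropagators, Thm 3.4 and (3.50) p.400] -/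
theorem norm_sum_clm_listProd_le {a : β → 𝔸} {M : β → ℝ} (hM : ∀ b, ‖a b‖ ≤ M b) (S : Finset σ) (φ : σ → 𝔸 →L[ℂ] ℂ)
    (w : σ → List β) :
    ‖∑ t ∈ S, φ t (((w t).map a).prod)‖ ≤ ∑ t ∈ S, ‖φ t‖ * ((w t).map M).prod :=
  (norm_sum_le _ _).trans (Finset.sum_le_sum fun t _ => (φ t).le_opNorm_of_le (norm_listProd_map_le hM (w t)))

end Words

/-! ## §2. Atoms on the chart ball `‖u‖ < R` -/

section Atoms

variable {F : Type*} [NormedAddCommGroup F] [NormedSpace ℂ F]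

omit [NormedSpace ℂ E] in
/-- A point of the ball has norm `< R` (plumbing). [folklore] -/
private theorem norm_lt_of_mem_ball {R : ℝ} {u : E} (hu : u ∈ ball (0 : E) R) : ‖u‖ < R := by
  rwa [mem_ball_zero_iff] at hu

/-- A continuous linear coordinate is bounded by `‖ℓ‖·R` on the ball (the chart coordinates `A(b)` of the complexified field;
plumbing over `ContinuousLinearMap.le_opNorm`). [folklore] -/
private theorem norm_clm_apply_le_of_mem_ball (ℓ : E →L[ℂ] F) {R : ℝ} {u : E} (hu : u ∈ ball (0 : E) R) : ‖ℓ u‖ ≤ ‖ℓ‖ * R :=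
  (ℓ.le_opNorm u).trans (mul_le_mul_of_nonneg_left (norm_lt_of_mem_ball hu).le (norm_nonneg _))

variable [CompleteSpace 𝔸]

omit [NormOneClass 𝔸] in
/-- THE EXPONENTIAL ATOM IS ENTIRE: `u ↦ exp(L u)` for a continuous linear `L : E → 𝔸` into a Banach algebra (the link variable
`U′(b) = exp iηA(b)` of [B9] p. 390 as a function of the complexified field — «analytic function of A(b)», p. 400; Mathlib
`NormedSpace.exp_analytic`). [cite: Balaban1985BackgroundPropagators, p.390 and Thm 3.4 p.400] -/
theorem differentiable_exp_clm (L : E →L[ℂ] 𝔸) : Differentiable ℂ fun u => exp (L u) :=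
  fun u => (NormedSpace.exp_analytic (𝕂 := ℂ) (L u)).differentiableAt.comp u L.differentiableAt

/-- … AND BOUNDED BY `e^{‖L‖R}` ON THE BALL (`‖exp a‖ ≤ e^{‖a‖}`, the tree's `QuantumLattice.norm_exp_le` BY NAME; the size of the
complex neighbourhood «ηA sufficiently small», p. 390). [cite: Balaban1985BackgroundPropagators, p.390 and Thm 3.4 p.400] -/
theorem norm_exp_clm_le_of_mem_ball (L : E →L[ℂ] 𝔸) {R : ℝ} {u : E} (hu : u ∈ ball (0 : E) R) :
    ‖exp (L u)‖ ≤ Real.exp (‖L‖ * R) :=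
  (norm_exp_le ℂ (L u)).trans (Real.exp_le_exp.2 (norm_clm_apply_le_of_mem_ball L hu))

omit [NormOneClass 𝔸] in
/-- The FORWARD TRANSPORT LETTER `u ↦ exp(L u)·U₀` («U = U′U₀», [B9] p. 390; `exp(iη ad A(b))R(U_b)` in (3.50) p. 400) is entire.
[cite: Balaban1985BackgroundPropagators, p.390 and (3.50) p.400] -/
theorem differentiable_exp_clm_mul_const (L : E →L[ℂ] 𝔸) (U₀ : 𝔸) : Differentiable ℂ fun u => exp (L u) * U₀ :=
  (differentiable_exp_clm L).mul_const U₀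

/-- … and bounded by `K₀·e^{ΛR}` on the ball once `‖L‖ ≤ Λ`, `‖U₀‖ ≤ K₀`. [cite: Balaban1985BackgroundPropagators, p.390 and (3.50) p.400] -/
theorem norm_exp_clm_mul_const_le (L : E →L[ℂ] 𝔸) (U₀ : 𝔸) {Λ K₀ R : ℝ} (hL : ‖L‖ ≤ Λ) (hU : ‖U₀‖ ≤ K₀) (hR : 0 ≤ R)
    {u : E} (hu : u ∈ ball (0 : E) R) : ‖exp (L u) * U₀‖ ≤ K₀ * Real.exp (Λ * R) := by
  refine (norm_mul_le _ _).trans ?_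
  rw [mul_comm]
  exact mul_le_mul hU ((norm_exp_clm_le_of_mem_ball L hu).trans (Real.exp_le_exp.2 (mul_le_mul_of_nonneg_right hL hR)))
    (norm_nonneg _) ((norm_nonneg _).trans hU)

omit [NormOneClass 𝔸] in
/-- The BACKWARD TRANSPORT LETTER `u ↦ V₀·exp(−L u)` (the reversed bond: `U(b)⁻¹ = U₀(b)⁻¹exp(−iηA(b))`, the holomorphic stand-in for
`U(b)*` off the real configurations, [B9] (3.5) p. 391, Thm 3.4 p. 400) is entire.
[cite: Balaban1985BackgroundPropagators, (3.5) p.391 and Thm 3.4 p.400] -/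
theorem differentiable_const_mul_exp_neg_clm (L : E →L[ℂ] 𝔸) (V₀ : 𝔸) : Differentiable ℂ fun u => V₀ * exp (-(L u)) := by
  have h : Differentiable ℂ fun u => exp ((-L) u) := differentiable_exp_clm (-L)
  simp only [FunLike.coe_neg, Pi.neg_apply] at h
  exact h.const_mul V₀

/-- … and bounded by `K₀·e^{ΛR}` on the ball once `‖L‖ ≤ Λ`, `‖V₀‖ ≤ K₀`. [cite: Balaban1985BackgroundPropagators, (3.5) p.391 and Thm 3.4 p.400] -/
theorem norm_const_mul_exp_neg_clm_le (L : E →L[ℂ] 𝔸) (V₀ : 𝔸) {Λ K₀ R : ℝ} (hL : ‖L‖ ≤ Λ) (hV : ‖V₀‖ ≤ K₀) (hR : 0 ≤ R)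
    {u : E} (hu : u ∈ ball (0 : E) R) : ‖V₀ * exp (-(L u))‖ ≤ K₀ * Real.exp (Λ * R) := by
  refine (norm_mul_le _ _).trans (mul_le_mul hV ?_ (norm_nonneg _) ((norm_nonneg _).trans hV))
  have h := norm_exp_clm_le_of_mem_ball (-L) hu
  rw [FunLike.coe_neg, Pi.neg_apply, norm_neg] at h
  exact h.trans (Real.exp_le_exp.2 (mul_le_mul_of_nonneg_right hL hR))

omit [NormedRing 𝔸] [NormedAlgebra ℂ 𝔸] [NormOneClass 𝔸] [CompleteSpace 𝔸] in
/-- The SCALAR exponential atom `u ↦ e^{ℓ(u)}` (abelian link variables; the entries of (3.23)–(3.26) for `G = U(1)`) is entire.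
[cite: Balaban1985BackgroundPropagators, p.390 and Thm 3.4 p.400] -/
theorem differentiable_cexp_clm (ℓ : E →L[ℂ] ℂ) : Differentiable ℂ fun u => Complex.exp (ℓ u) :=
  Complex.differentiable_exp.comp ℓ.differentiable

omit [NormedRing 𝔸] [NormedAlgebra ℂ 𝔸] [NormOneClass 𝔸] [CompleteSpace 𝔸] in
/-- … and bounded by `e^{‖ℓ‖R}` on the ball. [cite: Balaban1985BackgroundPropagators, p.390 and Thm 3.4 p.400] -/
theorem norm_cexp_clm_le_of_mem_ball (ℓ : E →L[ℂ] ℂ) {R : ℝ} {u : E} (hu : u ∈ ball (0 : E) R) :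
    ‖Complex.exp (ℓ u)‖ ≤ Real.exp (‖ℓ‖ * R) :=
  (Complex.norm_exp_le_exp_norm _).trans (Real.exp_le_exp.2 (norm_clm_apply_le_of_mem_ball ℓ hu))

end Atoms

/-! ## §3. ★ The packaging: census class (C) in the letter currency -/

section Packaging

variable {β σ : Type*}

/-- ★ **LOCAL OPERATORS WITH EXPONENTIAL-POLYNOMIAL ENTRIES HAVE THE LETTERS** (census class (C), generic form).  Letters
`g_b : E → 𝔸` holomorphic on the chart ball `‖u‖ < R` with bounds `‖g_b(u)‖ ≤ M_b` there; a matrix family `A : E → Matrix p p ℂ`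
whose entries ON THE BALL are finite sums of continuous-linear-functional images of word products,
`A(u)_{ij} = Σ_{s ∈ S(i,j)} φ_s(Π_{b ∈ w_s} g_b(u))` (representation coordinates of parallel transports along finite contours —
the shape of the entries of `Δ_U`, `Q*_k a Q_k`, `Δ′_a`, [B9] (3.23)–(3.26), at `U = U′U₀`, `U′ = exp iηA`, p. 390); RANGE `r₀`:
no term at all when `d₁(loc i, loc j) > r₀`; `a ≥ Σ_{s∈S(i,j)} ‖φ_s‖·Π_{b∈w_s} M_b` for every entry, `a ≥ 0`
⟹ `RawEntryLetters A loc R ρ (a·e^{ρ r₀})` at EVERY rate `ρ ≥ 0` — module 56A's `rawEntryLetters_of_range_family` with its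
holomorphy and bound hypotheses DISCHARGED at formula level.  (Agreement with the word expansion is asked on the ball only, so
`A` may be given by any global formula.)
[cite: Balaban1985BackgroundPropagators, (3.23)–(3.26) pp.394–395, Thm 3.4 p.400, (3.108) p.416] -/
theorem rawEntryLetters_of_words {g : β → E → 𝔸} {M : β → ℝ} {R : ℝ}
    (hg : ∀ b, DifferentiableOn ℂ (g b) (ball (0 : E) R)) (hM : ∀ b, ∀ u ∈ ball (0 : E) R, ‖g b u‖ ≤ M b)
    (S : p → p → Finset σ) (φ : σ → 𝔸 →L[ℂ] ℂ) (w : σ → List β) {A : E → Matrix p p ℂ}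
    (hA : ∀ u ∈ ball (0 : E) R, ∀ i j, A u i j = ∑ s ∈ S i j, φ s (((w s).map fun b => g b u).prod))
    {loc : p → UT Nf} {r₀ : ℝ} (hS : ∀ i j, r₀ < tdist1 Nf (loc i) (loc j) → S i j = ∅)
    {a : ℝ} (ha₀ : 0 ≤ a) (ha : ∀ i j, ∑ s ∈ S i j, ‖φ s‖ * ((w s).map M).prod ≤ a) {ρ : ℝ} (hρ : 0 ≤ ρ) :
    RawEntryLetters A loc R ρ (a * Real.exp (ρ * r₀)) := by
  refine rawEntryLetters_of_range_family (fun i j => ?_) hρ ha₀ (fun u hu i j hne => ?_) (fun u hu i j => ?_)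
  · exact (differentiableOn_sum_clm_listProd hg (S i j) φ w).congr fun u hu => hA u hu i j
  · by_contra hlt
    refine hne ?_
    rw [hA u hu i j, hS i j (lt_of_not_ge hlt), Finset.sum_empty]
  · rw [hA u hu i j]
    exact (norm_sum_clm_listProd_le (fun b => hM b u hu) (S i j) φ w).trans (ha i j)

end Packaging

/-! ## §4. Specialisations: exponential polynomials, polynomials, ★ transport words -/

section Special

variable {β σ : Type*}

omit [NormedRing 𝔸] [NormedAlgebra ℂ 𝔸] [NormOneClass 𝔸] in
/-- The norm of the scalar functional `x ↦ c·x` is `‖c‖` (plumbing). [folklore] -/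
private theorem norm_smul_id (c : ℂ) : ‖c • ContinuousLinearMap.id ℂ ℂ‖ = ‖c‖ := by
  rw [norm_smul, ContinuousLinearMap.norm_id, mul_one]

omit [NormedRing 𝔸] [NormedAlgebra ℂ 𝔸] [NormOneClass 𝔸] in
/-- **EXPONENTIAL POLYNOMIALS** (the abelian ∕ scalar form): entries `A(u)_{ij} = Σ_{s∈S(i,j)} c_s·e^{ℓ_s(u)}` ON THE BALL with
continuous linear coordinates `ℓ_s : E → ℂ` (a product `Π_b e^{iηℓ_b(u)}` of abelian link variables along a contour is ONE
exponential of the summed coordinate), range `r₀`, `a ≥ Σ_{s∈S(i,j)} ‖c_s‖e^{‖ℓ_s‖R}` for every entry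
⟹ `RawEntryLetters A loc R ρ (a·e^{ρ r₀})`, every `ρ ≥ 0`. [cite: Balaban1985BackgroundPropagators, (3.23)–(3.26) pp.394–395, Thm 3.4 p.400] -/
theorem rawEntryLetters_of_expPolynomial (S : p → p → Finset σ) (c : σ → ℂ) (ℓ : σ → E →L[ℂ] ℂ) {R : ℝ}
    {A : E → Matrix p p ℂ} (hA : ∀ u ∈ ball (0 : E) R, ∀ i j, A u i j = ∑ s ∈ S i j, c s * Complex.exp (ℓ s u))
    {loc : p → UT Nf} {r₀ : ℝ} (hS : ∀ i j, r₀ < tdist1 Nf (loc i) (loc j) → S i j = ∅)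
    {a : ℝ} (ha : ∀ i j, ∑ s ∈ S i j, ‖c s‖ * Real.exp (‖ℓ s‖ * R) ≤ a) (ha₀ : 0 ≤ a) {ρ : ℝ} (hρ : 0 ≤ ρ) :
    RawEntryLetters A loc R ρ (a * Real.exp (ρ * r₀)) := by
  refine rawEntryLetters_of_words (𝔸 := ℂ) (g := fun s u => Complex.exp (ℓ s u)) (M := fun s => Real.exp (‖ℓ s‖ * R))
    (fun s => (differentiable_cexp_clm (ℓ s)).differentiableOn) (fun s u hu => norm_cexp_clm_le_of_mem_ball (ℓ s) hu)
    S (fun s => c s • ContinuousLinearMap.id ℂ ℂ) (fun s => [s]) (fun u hu i j => ?_) hS ha₀ (fun i j => ?_) hρ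
  · rw [hA u hu i j]
    refine Finset.sum_congr rfl fun s _ => ?_
    simp only [List.map_cons, List.map_nil, List.prod_cons, List.prod_nil, mul_one, FunLike.coe_smul, Pi.smul_apply,
      ContinuousLinearMap.id_apply, smul_eq_mul]
  · refine (Finset.sum_le_sum fun s _ => le_of_eq ?_).trans (ha i j)
    simp only [List.map_cons, List.map_nil, List.prod_cons, List.prod_nil, mul_one, norm_smul_id]

omit [NormedRing 𝔸] [NormedAlgebra ℂ 𝔸] [NormOneClass 𝔸] in
/-- **POLYNOMIALS**: entries `A(u)_{ij} = Σ_{s∈S(i,j)} c_s·Π_{b∈w_s} ℓ_b(u)` ON THE BALL (ordered products of continuous linear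
coordinates — e.g. the Taylor pieces of the expansions (3.12), (3.37) in the fluctuation field), range `r₀`,
`a ≥ Σ_{s∈S(i,j)} ‖c_s‖·Π_{b∈w_s}(‖ℓ_b‖R)` ⟹ `RawEntryLetters A loc R ρ (a·e^{ρ r₀})`, every `ρ ≥ 0`.
[cite: Balaban1985BackgroundPropagators, (3.37) p.396, Thm 3.4 p.400] -/
theorem rawEntryLetters_of_polynomial (S : p → p → Finset σ) (c : σ → ℂ) (ℓ : β → E →L[ℂ] ℂ) (w : σ → List β) {R : ℝ}
    {A : E → Matrix p p ℂ}
    (hA : ∀ u ∈ ball (0 : E) R, ∀ i j, A u i j = ∑ s ∈ S i j, c s * ((w s).map fun b => ℓ b u).prod)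
    {loc : p → UT Nf} {r₀ : ℝ} (hS : ∀ i j, r₀ < tdist1 Nf (loc i) (loc j) → S i j = ∅)
    {a : ℝ} (ha : ∀ i j, ∑ s ∈ S i j, ‖c s‖ * ((w s).map fun b => ‖ℓ b‖ * R).prod ≤ a) (ha₀ : 0 ≤ a) {ρ : ℝ}
    (hρ : 0 ≤ ρ) : RawEntryLetters A loc R ρ (a * Real.exp (ρ * r₀)) := by
  refine rawEntryLetters_of_words (𝔸 := ℂ) (g := fun b u => ℓ b u) (M := fun b => ‖ℓ b‖ * R)
    (fun b => (ℓ b).differentiable.differentiableOn) (fun b u hu => norm_clm_apply_le_of_mem_ball (ℓ b) hu)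
    S (fun s => c s • ContinuousLinearMap.id ℂ ℂ) w (fun u hu i j => ?_) hS ha₀ (fun i j => ?_) hρ
  · rw [hA u hu i j]
    refine Finset.sum_congr rfl fun s _ => ?_
    simp only [FunLike.coe_smul, Pi.smul_apply, ContinuousLinearMap.id_apply, smul_eq_mul]
  · refine (Finset.sum_le_sum fun s _ => le_of_eq ?_).trans (ha i j)
    rw [norm_smul_id]

/-- ★ **TRANSPORT WORDS — THE LINK-VARIABLE SHAPE** of [B9] p. 390 «U′ = exp iηA, U = U′U₀» read on a complex chart: bonds `β`;
chart readings `L_b : E → 𝔸` (continuous linear: the complexified `iηA(b)` as a function of the chart point `u`) with `‖L_b‖ ≤ Λ`;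
background values `U₀(b)`, `V₀(b)` (print: `U₀(b)` and `U₀(b)⁻¹`, of norm `1` in `G`) with `‖U₀(b)‖, ‖V₀(b)‖ ≤ K₀`; letters on
`β ⊕ β` = FORWARD `exp(L_b u)·U₀(b)` ∕ BACKWARD `V₀(b)·exp(−L_b u)`; entries ON THE BALL `A(u)_{ij} = Σ_{s∈S(i,j)} φ_s(word)` —
representation coordinates `φ_s : 𝔸 → ℂ` of parallel transports along finite contours (the entries of the covariant Laplacian
`Δ_{U′U}` — (3.50) p. 400 VERBATIM: `η⁻²(2dλ(x) − Σ_b exp(iη ad A(b))R(U_b)λ(b₊))`, i.e. `L_b u = iη ad A(b)`, `U₀(b) = R(U_b)` — of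
`Q*_k a Q_k` with its block contours, of `Δ′_a`, (3.23)–(3.26)); RANGE `r₀`; `R ≥ 0`;
`a ≥ Σ_{s∈S(i,j)} ‖φ_s‖·(K₀e^{ΛR})^{|w_s|}` for every entry ⟹ `RawEntryLetters A loc R ρ (a·e^{ρ r₀})` at EVERY rate `ρ ≥ 0`.
NOTHING of Bałaban's operators is defined here: WHICH words, functionals, `Λ`, `K₀`, `r₀` they have is their owners' formula of record
(NODE 00 ∕ N06); this is the `hEL` ∕ `hAL` SHAPE for the local pieces.
[cite: Balaban1985BackgroundPropagators, p.390, (3.23)–(3.26) pp.394–395, Thm 3.4 and (3.50) p.400, (3.108) p.416] -/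
theorem rawEntryLetters_of_transportWords [CompleteSpace 𝔸] (L : β → E →L[ℂ] 𝔸) (U₀ V₀ : β → 𝔸) {Λ K₀ R : ℝ}
    (hL : ∀ b, ‖L b‖ ≤ Λ) (hU : ∀ b, ‖U₀ b‖ ≤ K₀) (hV : ∀ b, ‖V₀ b‖ ≤ K₀) (hR : 0 ≤ R)
    (S : p → p → Finset σ) (φ : σ → 𝔸 →L[ℂ] ℂ) (w : σ → List (β ⊕ β)) {A : E → Matrix p p ℂ}
    (hA : ∀ u ∈ ball (0 : E) R, ∀ i j, A u i j = ∑ s ∈ S i j,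
      φ s (((w s).map fun x => Sum.elim (fun b => exp (L b u) * U₀ b) (fun b => V₀ b * exp (-(L b u))) x).prod))
    {loc : p → UT Nf} {r₀ : ℝ} (hS : ∀ i j, r₀ < tdist1 Nf (loc i) (loc j) → S i j = ∅)
    {a : ℝ} (ha : ∀ i j, ∑ s ∈ S i j, ‖φ s‖ * (K₀ * Real.exp (Λ * R)) ^ (w s).length ≤ a) (ha₀ : 0 ≤ a)
    {ρ : ℝ} (hρ : 0 ≤ ρ) : RawEntryLetters A loc R ρ (a * Real.exp (ρ * r₀)) := by
  refine rawEntryLetters_of_words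
    (g := fun x u => Sum.elim (fun b => exp (L b u) * U₀ b) (fun b => V₀ b * exp (-(L b u))) x)
    (M := fun _ => K₀ * Real.exp (Λ * R)) (fun x => ?_) (fun x u hu => ?_) S φ w hA hS ha₀ (fun i j => ?_) hρ
  · cases x with
    | inl b => exact (differentiable_exp_clm_mul_const (L b) (U₀ b)).differentiableOn
    | inr b => exact (differentiable_const_mul_exp_neg_clm (L b) (V₀ b)).differentiableOn
  · cases x with
    | inl b => exact norm_exp_clm_mul_const_le (L b) (U₀ b) (hL b) (hU b) hR hu
    | inr b => exact norm_const_mul_exp_neg_clm_le (L b) (V₀ b) (hL b) (hV b) hR hu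
  · simpa only [listProd_map_const] using ha i j

end Special

/-! ## §5. Non-vacuity (A6): the one-bond U(1) covariant second difference -/

section Toy

omit [NormedAddCommGroup E] [NormedSpace ℂ E] [NormedRing 𝔸] [NormedAlgebra ℂ 𝔸] [NormOneClass 𝔸]

/-- **A6 WITNESS**: the one-bond `U(1)` covariant second difference `u ↦ [[1, −e^{iu}], [−e^{−iu}, 1]]` over the chart
`E = 𝔸 = ℂ` (two sites `p = Fin 2` at any torus locations `loc`, one bond, background `U₀ = 1`, the complexified phase `u`)
inhabits ★ `rawEntryLetters_of_transportWords` with EVERY binder discharged: `β = Unit`, `L = i·id`, `Λ = K₀ = 1`, words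
`[] ∕ [forward] ∕ [backward] ∕ []`, functionals `±id`, range `r₀ = d₁(loc 0, loc 1)`, `a = e^{R}` — letters `(R, ρ, e^{R}·e^{ρ r₀})`
for every `R ≥ 0`, `ρ ≥ 0`. [cite: Balaban1985BackgroundPropagators, (3.23) p.394] -/
theorem rawEntryLetters_oneBondU1 (loc : Fin 2 → UT Nf) {R : ℝ} (hR : 0 ≤ R) {ρ : ℝ} (hρ : 0 ≤ ρ) :
    RawEntryLetters (fun u : ℂ => !![(1 : ℂ), -Complex.exp (Complex.I * u); -Complex.exp (-(Complex.I * u)), 1]) loc R ρ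
      (Real.exp R * Real.exp (ρ * tdist1 Nf (loc 0) (loc 1))) := by
  have key := rawEntryLetters_of_transportWords (𝔸 := ℂ) (E := ℂ) (p := Fin 2) (β := Unit) (σ := Fin 2 × Fin 2)
    (fun _ => Complex.I • ContinuousLinearMap.id ℂ ℂ) (fun _ => 1) (fun _ => 1) (Λ := 1) (K₀ := 1) (R := R)
    (fun _ => by rw [norm_smul_id, Complex.norm_I]) (fun _ => by rw [norm_one]) (fun _ => by rw [norm_one]) hR
    (fun i j => {(i, j)})
    (fun s => (if s = (0, 1) ∨ s = (1, 0) then (-1 : ℂ) else 1) • ContinuousLinearMap.id ℂ ℂ)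
    (fun s => if s = (0, 1) then [Sum.inl ()] else if s = (1, 0) then [Sum.inr ()] else [])
    (A := fun u : ℂ => !![(1 : ℂ), -Complex.exp (Complex.I * u); -Complex.exp (-(Complex.I * u)), 1])
    (fun u _ i j => ?_) (loc := loc) (r₀ := tdist1 Nf (loc 0) (loc 1)) (fun i j hij => ?_)
    (a := Real.exp R) (fun i j => ?_) (Real.exp_nonneg _) hρ
  · exact key
  · -- the word expansion, entry by entry
    fin_cases i <;> fin_cases j <;>
      simp [Finset.sum_singleton, Complex.exp_eq_exp_ℂ]
  · -- range: every pair of the two locations is within `d₁(loc 0, loc 1)`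
    exfalso
    fin_cases i <;> fin_cases j
    · simp [tdist1_self] at hij; exact absurd hij (not_lt.2 (tdist1_nonneg _ _))
    · exact lt_irrefl _ hij
    · rw [tdist1_comm] at hij; exact lt_irrefl _ hij
    · simp [tdist1_self] at hij; exact absurd hij (not_lt.2 (tdist1_nonneg _ _))
  · -- the numeral `a = e^{R}`
    have h1 : (1 : ℝ) ≤ Real.exp R := Real.one_le_exp hR
    fin_cases i <;> fin_cases j <;>
      simp [Finset.sum_singleton, norm_smul_id, h1]

/-- … with GENUINE `u`-dependence: the `(0,1)` entry at `u = π` is `+1`, at `u = 0` it is `−1` (the A6 witness is not a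
`u`-constant family in disguise). [cite: Balaban1985BackgroundPropagators, (3.23) p.394] -/
theorem oneBondU1_entry_ne :
    (fun u : ℂ => !![(1 : ℂ), -Complex.exp (Complex.I * u); -Complex.exp (-(Complex.I * u)), 1]) (Real.pi : ℂ) 0 1
      ≠ (fun u : ℂ => !![(1 : ℂ), -Complex.exp (Complex.I * u); -Complex.exp (-(Complex.I * u)), 1]) 0 0 1 := by
  simp only [Matrix.of_apply, Matrix.cons_val', Matrix.cons_val_zero, Matrix.cons_val_one,
    Matrix.empty_val', Matrix.cons_val_fin_one, mul_zero, Complex.exp_zero]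
  rw [mul_comm, Complex.exp_pi_mul_I]
  norm_num

end Toy

/-! ## §6. (v1.1, append-only) The real point of the chart: at `u = 0` the transport letters are the background -/

section Zero

variable {β σ : Type*} {m n : Type}

omit [NormOneClass 𝔸] in
/-- AT THE BACKGROUND (`u = 0`, the centre of the chart: `U′ = exp iηA = 1`, `U = U₀`, [B9] p. 390) every transport letter is its
background value (`exp(L_b 0) = exp 0 = 1`), so a word product is the BACKGROUND WORD `Π_{x∈w}(U₀|V₀)(x)` — the parallel transport of
the background along the contour. [cite: Balaban1985BackgroundPropagators, p.390 and (3.50) p.400] -/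
theorem listProd_transport_zero (L : β → E →L[ℂ] 𝔸) (U₀ V₀ : β → 𝔸) (w : List (β ⊕ β)) :
    ((w.map fun x => Sum.elim (fun b => exp (L b (0 : E)) * U₀ b) (fun b => V₀ b * exp (-(L b (0 : E)))) x).prod)
      = (w.map (Sum.elim U₀ V₀)).prod := by
  congr 1
  refine List.map_congr_left fun x _ => ?_
  cases x with
  | inl b => simp only [Sum.elim_inl, map_zero, NormedSpace.exp_zero, one_mul]
  | inr b => simp only [Sum.elim_inr, map_zero, neg_zero, NormedSpace.exp_zero, mul_one]

omit [NormOneClass 𝔸] in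
/-- … hence the entries of a transport-word family AT THE BACKGROUND are the functionals of the background words,
`A(0)_{ik} = Σ_{s∈S(i,k)} φ_s(Π_{x∈w_s}(U₀|V₀)(x))` (`0 < R`, so that the background is a point of the chart ball; rectangular
`m × n` families, as in the sandwiches of `B13EntryLetterAlgebraFamily`) — the algebraic half of the junction's real-point identity
(`Aop 0 = M(Δ_a(U₀))` in `Thm/BalabanUVNodesN10EntryLettersOfN06RecordFaceC`); identifying the right-hand side with the real
operator's matrix of record is the consumer's (NODE 00's) reading. [cite: Balaban1985BackgroundPropagators, p.390, (3.23)–(3.26) pp.394–395] -/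
theorem transportWords_apply_zero (L : β → E →L[ℂ] 𝔸) (U₀ V₀ : β → 𝔸) {R : ℝ} (hR : 0 < R) (S : m → n → Finset σ)
    (φ : σ → 𝔸 →L[ℂ] ℂ) (w : σ → List (β ⊕ β)) {A : E → Matrix m n ℂ}
    (hA : ∀ u ∈ ball (0 : E) R, ∀ i k, A u i k = ∑ s ∈ S i k,
      φ s (((w s).map fun x => Sum.elim (fun b => exp (L b u) * U₀ b) (fun b => V₀ b * exp (-(L b u))) x).prod))
    (i : m) (k : n) : A 0 i k = ∑ s ∈ S i k, φ s (((w s).map (Sum.elim U₀ V₀)).prod) := by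
  rw [hA 0 (mem_ball_self hR) i k]
  exact Finset.sum_congr rfl fun s _ => by rw [listProd_transport_zero]

end Zero

end Literature.MathematicalPhysics.QuantumFieldTheory.Balaban1983to89.B13PolynomialRangeLetters
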